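import Mathlib
import Summits.Langlands.Statement
import Summits.Langlands.Langlands.Theorems.IrreducibilityBySelfDualityIrreducibleGL3CMContinuousSemisimplification
import Summits.Langlands.Langlands.Theorems.IrreducibilityBySelfDualityIrreducibleGL3CMCyclotomicUntwist
import Summits.Langlands.Langlands.Theorems.IrreducibilityBySelfDualityIrreducibleGL3CMReducibleCompanion
import Literature.NumberTheory.Automorphic.AlgebraicityParityGL
import Literature.NumberTheory.Automorphic.ArchParameterUnique
import Literature.NumberTheory.Automorphic.AutomorphicRepsGLSatakeFlathProofs
import Literature.NumberTheory.Automorphic.GLnAdelicStructureProofs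
import Literature.NumberTheory.GaloisRepresentations.WeakAbelianDirectSummandCyclotomicProofs
import HarnessLib

/-!
# Route `IrreducibilityBySelfDuality` — item `IrreducibleGL3CM` (stmt-Langlands-14068), FRAME FORM

The sector theorem of the route, as the pure implication it is filed as: GIVEN the route's cruxes
`RegularAdjointLiftCM`, `EssSelfDualIrreducibleCM`, `ReducibleForcesEssSelfDual` and inputs
`GaloisRepOfRegularAlgebraic`, `WeakAbelianSummandHecke`, `SelfdualGL3AdjointLift`, `PairLBoundaryJS`,
`ContragredientDatum`, `HeckeEigenvalueField`, for `K` CM, `π` cuspidal on `GL_3(𝔸_K)`, L-algebraic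
with a REGULAR infinity type, every `ℓ`, `ι` and EVERY `ρ : Γ_K → GL_3(ℚ̄_ℓ)` (not assumed semisimple)
which is Satake–Frobenius compatible with `(π, ι)` at almost all `v` in the summit's normalisation
(`arithFrobPolyOfSatake ι q_v 1 α`, roots `ι⁻¹(α_j⁻¹)`) is irreducible.

## Why this file exists (design constraint) and why it does NOT import the route module

The rev-4 copy of this item (stmt-Langlands-14327) was proved by
`Summit.Langlands.Langlands.Theorems.IrreducibleGL3CM.IrreducibleGL3CM_of`
(`Theorems/IrreducibilityBySelfDualityIrreducibleGL3CM.lean`, line `reducible-companion-dispatch`,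
kernel-checked).  That module imports the route module
`Summits.Langlands.Langlands.Theses.IrreducibilityBySelfDuality`; when the item closed, the gate
re-rendered the route file with `import <closing module>` (the `IrreducibleGL3CM_holds` link used to
discharge the hypothesis `hT : IrreducibleGL3CM` of the deciding theorem `closes`), which is an import
cycle — the route stopped materialising (incident 2026-08-15T23:51Z) and the planner re-filed the
item verbatim as stmt-Langlands-14068 (rev 5) to detach the cyclic link.

So the theorem below, `IrreducibleGL3CM.frame_proof`, is stated with the nine antecedents INLINED
VERBATIM (the bodies of the route decls, copied from the route file rev 12; inside
`EssSelfDualIrreducibleCM` the by-name reference to `RegularAdjointLiftCM` is inlined as well), so that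
its type is definitionally — by `δ`-unfolding of the ten route constants only — the route decl
`Summit.Langlands.Langlands.Theses.IrreducibilityBySelfDuality.IrreducibleGL3CM`, and the route file can
import this module without a cycle.  Imports: `Mathlib`, `Summits.Langlands.Statement`, Literature,
and the three LANDED stub modules of the line (none of which imports the route module).

## Proof (the line `reducible-companion-dispatch`, re-elaborated verbatim against the inlined text)

(i) `n = 3` is odd, so L-algebraic with a regular infinity type gives Clozel's regular algebraicity
(`InfinityType.isCAlgebraic_iff_isLAlgebraic_of_odd`, `HasInfinityType.map_a_eq`; proved inline);
(ii) the cyclotomic untwist `ρ' = ρ ⊗ χ_ℓ⁻¹` (`stub_cyclotomicUntwist`, landed) is compatible with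
`(π, ι)` at almost all places in the C-normalisation `arithFrobPolyOfSatake ι q_v 3 α` of the cruxes
(Satake parameters are unique, `hasSatakeParamAt_unique_holds`, which turns the summit's `∃ α` clause
into the cruxes' `∀ α` clause; `v ∤ ℓ` eventually, `FramedGaloisRep.eventually_natCast_not_mem`) and is
irreducible only if `ρ` is;
(iii) a continuous semisimplification `r` of `ρ'` with the same characteristic polynomials and
`ρ' g = 1 → r g = 1` (`stub_continuousSemisimplification`, landed) is again compatible a.e.;
(iv) if `ρ` were reducible then so would be `ρ'`, hence `r` (Brauer–Nesbitt with characteristic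
polynomials, `stub_not_isIrreducible_of_charpoly_eq`, landed), while `ReducibleForcesEssSelfDual` (fed
with the four inputs) makes `π` essentially self-dual at Satake level and excludes three stable lines,
and `EssSelfDualIrreducibleCM` (fed with lang.S27, Ramakrishnan Thm A and `RegularAdjointLiftCM`)
makes `r` irreducible — contradiction.  Level-one witness: `isCompact_glFiniteIntegralLevel_holds`.

No named-fact hypotheses, no definitions, no new cited results: every printed input (Buzzard–Gee 2014
Conj. 3.2.1/3.2.2 for the two normalisations; Böckle–Hui 2025 Thm 1.1; Clozel 1990 Thm 3.13) enters
only through the antecedents of the implication itself.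
-/

noncomputable section

set_option linter.dupNamespace false -- project-wide option (lakefile weak.linter.dupNamespace); `Summit.Langlands.Langlands` is the mandated namespace

-- (H5 of `AutomorphicRepsGL`) the place subtypes indexing the factors of `mixedSpace K` are `Fintype` classically;
-- the `open` lines below are those of the route file, so that the inlined bodies elaborate to the same terms.
open scoped BigOperators Topology Manifold Classical MeasureTheory ProbabilityTheory Matrix InnerProductSpace ComplexConjugate ContinuousMap
open Filter Set Function TopologicalSpace MeasureTheory
open scoped NumberField
open IsDedekindDomain
open Literature.NumberTheory.Automorphic Literature.NumberTheory.GaloisRepresentations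

namespace Summit.Langlands.Langlands.Theorems.IrreducibleGL3CM

/-! ### The item, frame form -/

/-- **`IrreducibleGL3CM`, frame form** (item stmt-Langlands-14068 of route `IrreducibilityBySelfDuality`):
the sector theorem — for `K` CM, `π` cuspidal on `GL_3(𝔸_K)`, L-algebraic with a regular infinity type,
every `ρ : Γ_K → GL_3(ℚ̄_ℓ)` Satake–Frobenius compatible with `(π, ι)` at almost all places (summit
normalisation `arithFrobPolyOfSatake ι q_v 1 α`) is irreducible — as an implication of the route's
three cruxes `RegularAdjointLiftCM`, `EssSelfDualIrreducibleCM`, `ReducibleForcesEssSelfDual` and six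
inputs `GaloisRepOfRegularAlgebraic`, `WeakAbelianSummandHecke`, `SelfdualGL3AdjointLift`,
`PairLBoundaryJS`, `ContragredientDatum`, `HeckeEigenvalueField`, all written out verbatim so that this
type `δ`-unfolds to the route decl
`Summit.Langlands.Langlands.Theses.IrreducibilityBySelfDuality.IrreducibleGL3CM`.
Proof: line `reducible-companion-dispatch` — regular algebraicity (odd rank), cyclotomic untwist to
the C-normalisation, continuous semisimplification, Brauer–Nesbitt, then `ReducibleForcesEssSelfDual`
and `EssSelfDualIrreducibleCM` fed with the inputs. -/
theorem frame_proof :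
    -- antecedent `RegularAdjointLiftCM` (route decl body, verbatim)
    ((∀ (F : Type) [Field F] [NumberField F] (hF1 : _) (hF2 : _) (hF3 : _) (P : Literature.NumberTheory.Automorphic.CuspidalAutomorphicRepData 3 F hF3) (η : Literature.NumberTheory.Automorphic.CuspidalAutomorphicRepData 1 F hF1), (∀ᶠ v in cofinite, ∀ α : Multiset ℂ, P.1.HasSatakeParamAt v α → ∃ e : ℂ, η.1.HasSatakeParamAt v {e} ∧ α.map (fun a => a⁻¹) = α.map (fun a => e * a)) → ∃ (π : Literature.NumberTheory.Automorphic.CuspidalAutomorphicRepData 2 F hF2) (ν : Literature.NumberTheory.Automorphic.CuspidalAutomorphicRepData 1 F hF1), (∀ (L : Type) [Field L] [NumberField L] [Algebra F L], Module.finrank F L = 2 → ¬ (∀ᶠ v in cofinite, ∀ β : Multiset ℂ, π.1.HasSatakeParamAt v β → β.map (fun b => (if ∃ w : IsDedekindDomain.HeightOneSpectrum (NumberField.RingOfIntegers L), w.asIdeal.under (NumberField.RingOfIntegers F) = v.asIdeal ∧ w.asIdeal.inertiaDeg (NumberField.RingOfIntegers F) = 1 then (1 : ℂ) else -1) * b)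 = β)) ∧ ∀ᶠ v in cofinite, ∀ β : Multiset ℂ, π.1.HasSatakeParamAt v β → ∃ d e : ℂ, ν.1.HasSatakeParamAt v {d} ∧ η.1.HasSatakeParamAt v {e} ∧ d ^ 2 * e = 1 ∧ P.1.HasSatakeParamAt v ((((β ×ˢ β).map (fun p : ℂ × ℂ => p.1 * p.2⁻¹)).erase 1).map (fun c => d * c))) → ∀ (K : Type) [Field K] [NumberField K], NumberField.IsCMField K → ∀ (h1 : _) (hcpt₂ : _) (hcpt : _) (π : Literature.NumberTheory.Automorphic.CuspidalAutomorphicRepData 3 K hcpt), π.1.IsRegularAlgebraic → (∃ η : Literature.NumberTheory.Automorphic.CuspidalAutomorphicRepData 1 K h1, ∀ᶠ v in cofinite, ∀ α : Multiset ℂ, π.1.HasSatakeParamAt v α → ∃ e : ℂ, η.1.HasSatakeParamAt v {e} ∧ α.map (fun a => a⁻¹) = α.map (fun a => e * a)) → ∃ (σ : Literature.NumberTheory.Automorphic.CuspidalAutomorphicRepData 2 K hcpt₂) (ν : Literature.NumberTheory.Automorphic.CuspidalAutomorphicRepData 1 K h1), σ.1.IsRegularAlgebraic ∧ ν.1.IsRegularAlgebraic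 ∧ (∀ (L : Type) [Field L] [NumberField L] [Algebra K L], Module.finrank K L = 2 → ¬ (∀ᶠ v in cofinite, ∀ β : Multiset ℂ, σ.1.HasSatakeParamAt v β → β.map (fun b => (if ∃ w : IsDedekindDomain.HeightOneSpectrum (NumberField.RingOfIntegers L), w.asIdeal.under (NumberField.RingOfIntegers K) = v.asIdeal ∧ w.asIdeal.inertiaDeg (NumberField.RingOfIntegers K) = 1 then (1 : ℂ) else -1) * b) = β)) ∧ ∀ᶠ v in cofinite, ∀ α β : Multiset ℂ, π.1.HasSatakeParamAt v α → σ.1.HasSatakeParamAt v β → ∃ d : ℂ, ν.1.HasSatakeParamAt v {d} ∧ α = (((β ×ˢ β).map (fun p : ℂ × ℂ => p.1 * p.2⁻¹)).erase 1).map (fun c => d * c)) →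
    -- antecedent `EssSelfDualIrreducibleCM` (route decl body, verbatim — with `RegularAdjointLiftCM` inlined)
    ((∀ (n : ℕ) (K : Type) [Field K] [NumberField K] (hcpt : Literature.NumberTheory.Automorphic.isCompact_glFiniteIntegralLevel n K), (NumberField.IsTotallyReal K ∨ NumberField.IsCMField K) → ∀ (π : Literature.NumberTheory.Automorphic.CuspidalAutomorphicRepData n K hcpt), π.1.IsRegularAlgebraic → ∀ (ℓ : ℕ) [Fact ℓ.Prime] (ι : PadicAlgCl ℓ ≃+* ℂ), ∃ r : Literature.NumberTheory.GaloisRepresentations.FramedGaloisRep K (PadicAlgCl ℓ) n, r.toGaloisRep.IsSemisimple ∧ ∀ (v : IsDedekindDomain.HeightOneSpectrum (NumberField.RingOfIntegers K)) (α : Multiset ℂ), π.1.HasSatakeParamAt v α → ((ℓ : ℕ) : NumberField.RingOfIntegers K) ∉ v.asIdeal → r.IsUnramifiedAt v ∧ r.HasFrobCharpolyAt v (Literature.NumberTheory.Automorphic.arithFrobPolyOfSatake ι v.residueCard n α)) → (∀ (F : Type) [Field F] [NumberField F] (hF1 : _) (hF2 : _) (hF3 : _) (P : Literature.NumberTheory.Automorphic.CuspidalAutomorphicRepData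 3 F hF3) (η : Literature.NumberTheory.Automorphic.CuspidalAutomorphicRepData 1 F hF1), (∀ᶠ v in cofinite, ∀ α : Multiset ℂ, P.1.HasSatakeParamAt v α → ∃ e : ℂ, η.1.HasSatakeParamAt v {e} ∧ α.map (fun a => a⁻¹) = α.map (fun a => e * a)) → ∃ (π : Literature.NumberTheory.Automorphic.CuspidalAutomorphicRepData 2 F hF2) (ν : Literature.NumberTheory.Automorphic.CuspidalAutomorphicRepData 1 F hF1), (∀ (L : Type) [Field L] [NumberField L] [Algebra F L], Module.finrank F L = 2 → ¬ (∀ᶠ v in cofinite, ∀ β : Multiset ℂ, π.1.HasSatakeParamAt v β → β.map (fun b => (if ∃ w : IsDedekindDomain.HeightOneSpectrum (NumberField.RingOfIntegers L), w.asIdeal.under (NumberField.RingOfIntegers F) = v.asIdeal ∧ w.asIdeal.inertiaDeg (NumberField.RingOfIntegers F) = 1 then (1 : ℂ) else -1) * b) = β)) ∧ ∀ᶠ v in cofinite, ∀ β : Multiset ℂ, π.1.HasSatakeParamAt v β → ∃ d e : ℂ, ν.1.HasSatakeParamAt v {d} ∧ η.1.HasSatakeParamAt v {e} ∧ d ^ 2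 * e = 1 ∧ P.1.HasSatakeParamAt v ((((β ×ˢ β).map (fun p : ℂ × ℂ => p.1 * p.2⁻¹)).erase 1).map (fun c => d * c))) → ((∀ (F : Type) [Field F] [NumberField F] (hF1 : _) (hF2 : _) (hF3 : _) (P : Literature.NumberTheory.Automorphic.CuspidalAutomorphicRepData 3 F hF3) (η : Literature.NumberTheory.Automorphic.CuspidalAutomorphicRepData 1 F hF1), (∀ᶠ v in cofinite, ∀ α : Multiset ℂ, P.1.HasSatakeParamAt v α → ∃ e : ℂ, η.1.HasSatakeParamAt v {e} ∧ α.map (fun a => a⁻¹) = α.map (fun a => e * a)) → ∃ (π : Literature.NumberTheory.Automorphic.CuspidalAutomorphicRepData 2 F hF2) (ν : Literature.NumberTheory.Automorphic.CuspidalAutomorphicRepData 1 F hF1), (∀ (L : Type) [Field L] [NumberField L] [Algebra F L], Module.finrank F L = 2 → ¬ (∀ᶠ v in cofinite, ∀ β : Multiset ℂ, π.1.HasSatakeParamAt v β → β.map (fun b => (if ∃ w : IsDedekindDomain.HeightOneSpectrum (NumberField.RingOfIntegers L), w.asIdeal.under (NumberField.RingOfIntegers F) = v.asIdeal ∧ w.asIdeal.inertiaDeg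 (NumberField.RingOfIntegers F) = 1 then (1 : ℂ) else -1) * b) = β)) ∧ ∀ᶠ v in cofinite, ∀ β : Multiset ℂ, π.1.HasSatakeParamAt v β → ∃ d e : ℂ, ν.1.HasSatakeParamAt v {d} ∧ η.1.HasSatakeParamAt v {e} ∧ d ^ 2 * e = 1 ∧ P.1.HasSatakeParamAt v ((((β ×ˢ β).map (fun p : ℂ × ℂ => p.1 * p.2⁻¹)).erase 1).map (fun c => d * c))) → ∀ (K : Type) [Field K] [NumberField K], NumberField.IsCMField K → ∀ (h1 : _) (hcpt₂ : _) (hcpt : _) (π : Literature.NumberTheory.Automorphic.CuspidalAutomorphicRepData 3 K hcpt), π.1.IsRegularAlgebraic → (∃ η : Literature.NumberTheory.Automorphic.CuspidalAutomorphicRepData 1 K h1, ∀ᶠ v in cofinite, ∀ α : Multiset ℂ, π.1.HasSatakeParamAt v α → ∃ e : ℂ, η.1.HasSatakeParamAt v {e} ∧ α.map (fun a => a⁻¹) = α.map (fun a => e * a)) → ∃ (σ : Literature.NumberTheory.Automorphic.CuspidalAutomorphicRepData 2 K hcpt₂) (ν : Literature.NumberTheory.Automorphic.CuspidalAutomorphicRepData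 1 K h1), σ.1.IsRegularAlgebraic ∧ ν.1.IsRegularAlgebraic ∧ (∀ (L : Type) [Field L] [NumberField L] [Algebra K L], Module.finrank K L = 2 → ¬ (∀ᶠ v in cofinite, ∀ β : Multiset ℂ, σ.1.HasSatakeParamAt v β → β.map (fun b => (if ∃ w : IsDedekindDomain.HeightOneSpectrum (NumberField.RingOfIntegers L), w.asIdeal.under (NumberField.RingOfIntegers K) = v.asIdeal ∧ w.asIdeal.inertiaDeg (NumberField.RingOfIntegers K) = 1 then (1 : ℂ) else -1) * b) = β)) ∧ ∀ᶠ v in cofinite, ∀ α β : Multiset ℂ, π.1.HasSatakeParamAt v α → σ.1.HasSatakeParamAt v β → ∃ d : ℂ, ν.1.HasSatakeParamAt v {d} ∧ α = (((β ×ˢ β).map (fun p : ℂ × ℂ => p.1 * p.2⁻¹)).erase 1).map (fun c => d * c)) → ∀ (K : Type) [Field K] [NumberField K], NumberField.IsCMField K → ∀ (h1 : _) (hcpt : _) (π : Literature.NumberTheory.Automorphic.CuspidalAutomorphicRepData 3 K hcpt), π.1.IsRegularAlgebraic → (∃ η : Literature.NumberTheory.Automorphic.CuspidalAutomorphicRepData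 1 K h1, ∀ᶠ v in cofinite, ∀ α : Multiset ℂ, π.1.HasSatakeParamAt v α → ∃ e : ℂ, η.1.HasSatakeParamAt v {e} ∧ α.map (fun a => a⁻¹) = α.map (fun a => e * a)) → ∀ (ℓ : ℕ) [Fact ℓ.Prime] (ι : PadicAlgCl ℓ ≃+* ℂ) (r : Literature.NumberTheory.GaloisRepresentations.FramedGaloisRep K (PadicAlgCl ℓ) 3), r.toGaloisRep.IsSemisimple → (∀ᶠ v in cofinite, ∀ α : Multiset ℂ, π.1.HasSatakeParamAt v α → r.IsUnramifiedAt v ∧ r.HasFrobCharpolyAt v (Literature.NumberTheory.Automorphic.arithFrobPolyOfSatake ι v.residueCard 3 α)) → ¬ (∃ x : Fin 3 → (Fin 3 → PadicAlgCl ℓ), LinearIndependent (PadicAlgCl ℓ) x ∧ ∀ (i : Fin 3) (g : Field.absoluteGaloisGroup K), ∃ c : PadicAlgCl ℓ, r.toGaloisRep g (x i) = c • x i) → r.toGaloisRep.IsIrreducible) →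
    -- antecedent `ReducibleForcesEssSelfDual` (route decl body, verbatim)
    ((∀ (K : Type) [Field K] [NumberField K] (h1 : _) (ℓ : ℕ) [Fact ℓ.Prime] (n : ℕ) (E : Type) [Field E] [NumberField E] (e : E →+* PadicAlgCl ℓ) (ρ : Literature.NumberTheory.GaloisRepresentations.FramedGaloisRep K (PadicAlgCl ℓ) n), ρ.toGaloisRep.IsSemisimple → (∀ᶠ v in cofinite, ρ.IsUnramifiedAt v ∧ ∃ P : Polynomial E, ρ.HasFrobCharpolyAt v (P.map e)) → ∀ (ψ : Literature.NumberTheory.GaloisRepresentations.FramedGaloisRep K (PadicAlgCl ℓ) 1), (∀ᶠ v in cofinite, ρ.IsUnramifiedAt v ∧ ψ.IsUnramifiedAt v ∧ ∀ 𝔓 ∈ v.primesAbove, ∀ σ : Field.absoluteGaloisGroup K, IsArithFrobAt (NumberField.RingOfIntegers K) σ 𝔓 → ψ.charpoly σ ∣ ρ.charpoly σ) → ∀ (ι : PadicAlgCl ℓ ≃+* ℂ), ∃ χ : Literature.NumberTheory.Automorphic.CuspidalAutomorphicRepData 1 K h1, χ.1.IsRegularAlgebraic ∧ ∀ᶠ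 v in cofinite, ∃ c : ℂ, χ.1.HasSatakeParamAt v {c} ∧ ψ.IsUnramifiedAt v ∧ ψ.HasFrobCharpolyAt v (Literature.NumberTheory.Automorphic.arithFrobPolyOfSatake ι v.residueCard 1 {c})) → (∀ (n : ℕ) (K : Type) [Field K] [NumberField K] (hcpt : _) (π : Literature.NumberTheory.Automorphic.CuspidalAutomorphicRepData n K hcpt), π.1.IsRegularAlgebraic → ∃ E : Subfield ℂ, FiniteDimensional ℚ E ∧ ∀ᶠ v in cofinite, ∀ α : Multiset ℂ, π.1.HasSatakeParamAt v α → ∀ i ≤ n, ((((Real.sqrt (v.residueCard : ℝ)) : ℝ) : ℂ) ^ (i * (n - i))) * α.esymm i ∈ E) → (∀ (n m : ℕ) (F : Type) [Field F] [NumberField F] (hF : _) (hF' : _), 0 < n → 0 < m → ∀ (π : Literature.NumberTheory.Automorphic.CuspidalAutomorphicRepData n F hF) (π' : Literature.NumberTheory.Automorphic.CuspidalAutomorphicRepData m F hF'), ∃ S₀ : Set (IsDedekindDomain.HeightOneSpectrum (NumberField.RingOfIntegers F)), S₀.Finite ∧ ∀ {S : Set (IsDedekindDomain.HeightOneSpectrum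 (NumberField.RingOfIntegers F))}, S.Finite → S₀ ⊆ S → ∀ {α β : IsDedekindDomain.HeightOneSpectrum (NumberField.RingOfIntegers F) → Multiset ℂ}, (∀ w ∉ S, π.1.HasSatakeParamAt w (α w)) → (∀ w ∉ S, π'.1.HasSatakeParamAt w (β w)) → (∀ w ∉ S, ‖(α w).prod‖ = 1) → (∀ w ∉ S, ‖(β w).prod‖ = 1) → ∀ {s₀ : ℂ}, s₀.re = 1 → ¬ (n = m ∧ ∀ᶠ w in cofinite, (α w).map ((((w.residueCard : ℂ) ^ (1 - s₀))) * ·) = (β w).map (·⁻¹)) → ∃ c : ℂ, c ≠ 0 ∧ Tendsto (fun s : ℂ => ∏' w : {w : IsDedekindDomain.HeightOneSpectrum (NumberField.RingOfIntegers F) // w ∉ S}, ((Literature.NumberTheory.Automorphic.satakePairPolynomial (α w.1) (β w.1)).eval ((w.1.residueCard : ℂ) ^ (-s)))⁻¹) (𝓝[{s : ℂ | 1 < s.re}] s₀) (𝓝 c)) → (∀ (n : ℕ) (K : Type) [Field K] [NumberField K] (hcpt : Literature.NumberTheory.Automorphic.isCompact_glFiniteIntegralLevel n K) (π : Literature.NumberTheory.Automorphic.CuspidalAutomorphicRepData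 n K hcpt), ∃ π' : Literature.NumberTheory.Automorphic.CuspidalAutomorphicRepData n K hcpt, ∀ (v : IsDedekindDomain.HeightOneSpectrum (NumberField.RingOfIntegers K)) (α : Multiset ℂ), π.1.HasSatakeParamAt v α → π'.1.HasSatakeParamAt v (α.map (·⁻¹))) → ∀ (K : Type) [Field K] [NumberField K] (h1 : _) (hcpt : _) (π : Literature.NumberTheory.Automorphic.CuspidalAutomorphicRepData 3 K hcpt), π.1.IsRegularAlgebraic → ∀ (ℓ : ℕ) [Fact ℓ.Prime] (ι : PadicAlgCl ℓ ≃+* ℂ) (r : Literature.NumberTheory.GaloisRepresentations.FramedGaloisRep K (PadicAlgCl ℓ) 3), r.toGaloisRep.IsSemisimple → (∀ᶠ v in cofinite, ∀ α : Multiset ℂ, π.1.HasSatakeParamAt v α → r.IsUnramifiedAt v ∧ r.HasFrobCharpolyAt v (Literature.NumberTheory.Automorphic.arithFrobPolyOfSatake ι v.residueCard 3 α)) → (¬ r.toGaloisRep.IsIrreducible → (∃ η : Literature.NumberTheory.Automorphic.CuspidalAutomorphicRepData 1 K h1, ∀ᶠ v in cofinite, ∀ α : Multiset ℂ, π.1.HasSatakeParamAt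 v α → ∃ e : ℂ, η.1.HasSatakeParamAt v {e} ∧ α.map (fun a => a⁻¹) = α.map (fun a => e * a))) ∧ ¬ (∃ x : Fin 3 → (Fin 3 → PadicAlgCl ℓ), LinearIndependent (PadicAlgCl ℓ) x ∧ ∀ (i : Fin 3) (g : Field.absoluteGaloisGroup K), ∃ c : PadicAlgCl ℓ, r.toGaloisRep g (x i) = c • x i)) →
    -- antecedent `GaloisRepOfRegularAlgebraic` (route decl body, verbatim)
    (∀ (n : ℕ) (K : Type) [Field K] [NumberField K] (hcpt : Literature.NumberTheory.Automorphic.isCompact_glFiniteIntegralLevel n K), (NumberField.IsTotallyReal K ∨ NumberField.IsCMField K) → ∀ (π : Literature.NumberTheory.Automorphic.CuspidalAutomorphicRepData n K hcpt), π.1.IsRegularAlgebraic → ∀ (ℓ : ℕ) [Fact ℓ.Prime] (ι : PadicAlgCl ℓ ≃+* ℂ), ∃ r : Literature.NumberTheory.GaloisRepresentations.FramedGaloisRep K (PadicAlgCl ℓ) n, r.toGaloisRep.IsSemisimple ∧ ∀ (v : IsDedekindDomain.HeightOneSpectrum (NumberField.RingOfIntegers K)) (α : Multiset ℂ), π.1.HasSatakeParamAt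 v α → ((ℓ : ℕ) : NumberField.RingOfIntegers K) ∉ v.asIdeal → r.IsUnramifiedAt v ∧ r.HasFrobCharpolyAt v (Literature.NumberTheory.Automorphic.arithFrobPolyOfSatake ι v.residueCard n α)) →
    -- antecedent `WeakAbelianSummandHecke` (route decl body, verbatim)
    (∀ (K : Type) [Field K] [NumberField K] (h1 : _) (ℓ : ℕ) [Fact ℓ.Prime] (n : ℕ) (E : Type) [Field E] [NumberField E] (e : E →+* PadicAlgCl ℓ) (ρ : Literature.NumberTheory.GaloisRepresentations.FramedGaloisRep K (PadicAlgCl ℓ) n), ρ.toGaloisRep.IsSemisimple → (∀ᶠ v in cofinite, ρ.IsUnramifiedAt v ∧ ∃ P : Polynomial E, ρ.HasFrobCharpolyAt v (P.map e)) → ∀ (ψ : Literature.NumberTheory.GaloisRepresentations.FramedGaloisRep K (PadicAlgCl ℓ) 1), (∀ᶠ v in cofinite, ρ.IsUnramifiedAt v ∧ ψ.IsUnramifiedAt v ∧ ∀ 𝔓 ∈ v.primesAbove, ∀ σ : Field.absoluteGaloisGroup K, IsArithFrobAt (NumberField.RingOfIntegers K) σ 𝔓 → ψ.charpoly σ ∣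 ρ.charpoly σ) → ∀ (ι : PadicAlgCl ℓ ≃+* ℂ), ∃ χ : Literature.NumberTheory.Automorphic.CuspidalAutomorphicRepData 1 K h1, χ.1.IsRegularAlgebraic ∧ ∀ᶠ v in cofinite, ∃ c : ℂ, χ.1.HasSatakeParamAt v {c} ∧ ψ.IsUnramifiedAt v ∧ ψ.HasFrobCharpolyAt v (Literature.NumberTheory.Automorphic.arithFrobPolyOfSatake ι v.residueCard 1 {c})) →
    -- antecedent `SelfdualGL3AdjointLift` (route decl body, verbatim)
    (∀ (F : Type) [Field F] [NumberField F] (hF1 : _) (hF2 : _) (hF3 : _) (P : Literature.NumberTheory.Automorphic.CuspidalAutomorphicRepData 3 F hF3) (η : Literature.NumberTheory.Automorphic.CuspidalAutomorphicRepData 1 F hF1), (∀ᶠ v in cofinite, ∀ α : Multiset ℂ, P.1.HasSatakeParamAt v α → ∃ e : ℂ, η.1.HasSatakeParamAt v {e} ∧ α.map (fun a => a⁻¹) = α.map (fun a => e * a)) → ∃ (π : Literature.NumberTheory.Automorphic.CuspidalAutomorphicRepData 2 F hF2) (ν : Literature.NumberTheory.Automorphic.CuspidalAutomorphicRepData 1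 F hF1), (∀ (L : Type) [Field L] [NumberField L] [Algebra F L], Module.finrank F L = 2 → ¬ (∀ᶠ v in cofinite, ∀ β : Multiset ℂ, π.1.HasSatakeParamAt v β → β.map (fun b => (if ∃ w : IsDedekindDomain.HeightOneSpectrum (NumberField.RingOfIntegers L), w.asIdeal.under (NumberField.RingOfIntegers F) = v.asIdeal ∧ w.asIdeal.inertiaDeg (NumberField.RingOfIntegers F) = 1 then (1 : ℂ) else -1) * b) = β)) ∧ ∀ᶠ v in cofinite, ∀ β : Multiset ℂ, π.1.HasSatakeParamAt v β → ∃ d e : ℂ, ν.1.HasSatakeParamAt v {d} ∧ η.1.HasSatakeParamAt v {e} ∧ d ^ 2 * e = 1 ∧ P.1.HasSatakeParamAt v ((((β ×ˢ β).map (fun p : ℂ × ℂ => p.1 * p.2⁻¹)).erase 1).map (fun c => d * c))) →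
    -- antecedent `PairLBoundaryJS` (route decl body, verbatim)
    (∀ (n m : ℕ) (F : Type) [Field F] [NumberField F] (hF : _) (hF' : _), 0 < n → 0 < m → ∀ (π : Literature.NumberTheory.Automorphic.CuspidalAutomorphicRepData n F hF) (π' : Literature.NumberTheory.Automorphic.CuspidalAutomorphicRepData m F hF'), ∃ S₀ : Set (IsDedekindDomain.HeightOneSpectrum (NumberField.RingOfIntegers F)), S₀.Finite ∧ ∀ {S : Set (IsDedekindDomain.HeightOneSpectrum (NumberField.RingOfIntegers F))}, S.Finite → S₀ ⊆ S → ∀ {α β : IsDedekindDomain.HeightOneSpectrum (NumberField.RingOfIntegers F) → Multiset ℂ}, (∀ w ∉ S, π.1.HasSatakeParamAt w (α w)) → (∀ w ∉ S, π'.1.HasSatakeParamAt w (β w)) → (∀ w ∉ S, ‖(α w).prod‖ = 1) → (∀ w ∉ S, ‖(β w).prod‖ = 1) → ∀ {s₀ : ℂ}, s₀.re = 1 → ¬ (n = m ∧ ∀ᶠ w in cofinite, (α w).map ((((w.residueCard : ℂ) ^ (1 - s₀))) * ·) = (β w).map (·⁻¹)) → ∃ c : ℂ, c ≠ 0 ∧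 Tendsto (fun s : ℂ => ∏' w : {w : IsDedekindDomain.HeightOneSpectrum (NumberField.RingOfIntegers F) // w ∉ S}, ((Literature.NumberTheory.Automorphic.satakePairPolynomial (α w.1) (β w.1)).eval ((w.1.residueCard : ℂ) ^ (-s)))⁻¹) (𝓝[{s : ℂ | 1 < s.re}] s₀) (𝓝 c)) →
    -- antecedent `ContragredientDatum` (route decl body, verbatim)
    (∀ (n : ℕ) (K : Type) [Field K] [NumberField K] (hcpt : Literature.NumberTheory.Automorphic.isCompact_glFiniteIntegralLevel n K) (π : Literature.NumberTheory.Automorphic.CuspidalAutomorphicRepData n K hcpt), ∃ π' : Literature.NumberTheory.Automorphic.CuspidalAutomorphicRepData n K hcpt, ∀ (v : IsDedekindDomain.HeightOneSpectrum (NumberField.RingOfIntegers K)) (α : Multiset ℂ), π.1.HasSatakeParamAt v α → π'.1.HasSatakeParamAt v (α.map (·⁻¹))) →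
    -- antecedent `HeckeEigenvalueField` (route decl body, verbatim)
    (∀ (n : ℕ) (K : Type) [Field K] [NumberField K] (hcpt : _) (π : Literature.NumberTheory.Automorphic.CuspidalAutomorphicRepData n K hcpt), π.1.IsRegularAlgebraic → ∃ E : Subfield ℂ, FiniteDimensional ℚ E ∧ ∀ᶠ v in cofinite, ∀ α : Multiset ℂ, π.1.HasSatakeParamAt v α → ∀ i ≤ n, ((((Real.sqrt (v.residueCard : ℝ)) : ℝ) : ℂ) ^ (i * (n - i))) * α.esymm i ∈ E) →
    -- conclusion: the sector theorem in the summit normalisation (route decl body, verbatim)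
    ∀ (K : Type) [Field K] [NumberField K], NumberField.IsCMField K → ∀ (hcpt : Literature.NumberTheory.Automorphic.isCompact_glFiniteIntegralLevel 3 K) (π : Literature.NumberTheory.Automorphic.CuspidalAutomorphicRepData 3 K hcpt), π.1.IsLAlgebraic → (∃ T : Literature.NumberTheory.Automorphic.InfinityType K 3, π.1.HasInfinityType T ∧ T.IsRegular) → ∀ (ℓ : ℕ) [Fact ℓ.Prime] (ι : PadicAlgCl ℓ ≃+* ℂ) (ρ : Literature.NumberTheory.GaloisRepresentations.FramedGaloisRep K (PadicAlgCl ℓ) 3), (∀ᶠ v : IsDedekindDomain.HeightOneSpectrum (NumberField.RingOfIntegers K) in cofinite, ∃ α : Multiset ℂ, π.1.HasSatakeParamAt v α ∧ ρ.IsUnramifiedAt v ∧ ρ.HasFrobCharpolyAt v (Literature.NumberTheory.Automorphic.arithFrobPolyOfSatake ι v.residueCard 1 α)) → ρ.toGaloisRep.IsIrreducible := by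
  intro hRAL hES hRF hGR hWA hSD hPL hCD hHE K _ _ hCM hcpt π hL hT ℓ _ ι ρ h
  -- (i) regular algebraicity: `n = 3` is odd, so an L-algebraic infinity type `T₁` of `π` is C-algebraic
  -- (`InfinityType.isCAlgebraic_iff_isLAlgebraic_of_odd`), and it is regular because regularity only reads
  -- the `a`-multisets, which agree for all infinity types of `π` (`HasInfinityType.map_a_eq`)
  have hRA : π.1.IsRegularAlgebraic := by
    obtain ⟨T₁, hT₁, hL₁⟩ := hL
    obtain ⟨T₂, hT₂, hR₂⟩ := hT
    refine ⟨T₁, hT₁, ?_, fun σ => ?_⟩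
    · exact (InfinityType.isCAlgebraic_iff_isLAlgebraic_of_odd (by decide : Odd 3) T₁).mpr hL₁
    · rw [AutomorphicRepData.HasInfinityType.map_a_eq π.1 hT₁ hT₂ σ]
      exact hR₂ σ
  -- (ii) the cyclotomic untwist, compatible a.e. in the `m = 3` normalisation
  obtain ⟨ρ', himp, hρ'v⟩ := stub_cyclotomicUntwist K ℓ ι ρ
  have hρ' : ∀ᶠ v : HeightOneSpectrum (𝓞 K) in cofinite, ∀ α : Multiset ℂ, π.1.HasSatakeParamAt v α →
      ρ'.IsUnramifiedAt v ∧ ρ'.HasFrobCharpolyAt v (arithFrobPolyOfSatake ι v.residueCard 3 α) := by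
    filter_upwards [h, FramedGaloisRep.eventually_natCast_not_mem K ℓ] with v hv hℓ
    obtain ⟨α₀, hα₀, hur, hcp⟩ := hv
    intro α hα
    obtain rfl : α = α₀ := AutomorphicRepData.hasSatakeParamAt_unique_holds π.1 hα hα₀
    obtain ⟨hur', hcp'⟩ := hρ'v v hℓ hur
    exact ⟨hur', hcp' α hcp⟩
  -- (iii) the continuous semisimplification, still compatible a.e.
  obtain ⟨r, hrss, hrcp, hrker⟩ := stub_continuousSemisimplification K ℓ 3 ρ'
  have hr : ∀ᶠ v : HeightOneSpectrum (𝓞 K) in cofinite, ∀ α : Multiset ℂ, π.1.HasSatakeParamAt v α →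
      r.IsUnramifiedAt v ∧ r.HasFrobCharpolyAt v (arithFrobPolyOfSatake ι v.residueCard 3 α) := by
    filter_upwards [hρ'] with v hv α hα
    obtain ⟨hur, hcp⟩ := hv α hα
    exact ⟨fun 𝔓 h𝔓 σ hσ => hrker σ (hur 𝔓 h𝔓 σ hσ),
      fun 𝔓 h𝔓 σ hσ => (hrcp σ).trans (hcp 𝔓 h𝔓 σ hσ)⟩
  -- (iv) dispatch
  by_contra hirr
  have hρ'irr : ¬ ρ'.toGaloisRep.IsIrreducible := fun h' => hirr (himp h')
  have hrirr : ¬ r.toGaloisRep.IsIrreducible :=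
    stub_not_isIrreducible_of_charpoly_eq K ℓ 3 ρ' r hrss hrcp hρ'irr
  have h1 : isCompact_glFiniteIntegralLevel 1 K := isCompact_glFiniteIntegralLevel_holds 1 K
  obtain ⟨hess, h3⟩ := hRF hWA hHE hPL hCD K h1 hcpt π hRA ℓ ι r hrss hr
  exact hrirr (hES hGR hSD hRAL K hCM h1 hcpt π hRA (hess hrirr) ℓ ι r hrss hr h3)

end Summit.Langlands.Langlands.Theorems.IrreducibleGL3CM

end
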